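import Literature.Claims.NS.ZhangJiaHong2026
import Literature.Analysis.FluidPDE.NSQuasipotential
import Literature.Analysis.FluidPDE.LerayLocalRegularH1Proofs
import HarnessLib

/-!
# C118 `ZhangJiaHong2026` — kernel records for the NS-claims sweep (D-0090), refuter-8

Typed record: `Literature.Claims.NS.ZhangJiaHong2026` (typist-2 g2, p485091), J. H. Zhang, Preprints.org
202601.0992 v1 (2026): Step 2 = §4.1.1–4.1.2 print p.5 («uniform boundedness of high-order derivatives …
this paper obtains u ∈ C^∞((0,∞); H^∞)» for every global Leray–Hopf solution).

Kernel facts (sorry-free, standard axioms):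

* `not_UniformHighOrderBounds` — the Step AS TYPED (pointwise smoothness on `(0,∞) × ℝ³` of the GIVEN
  function `u`) is false for a bookkeeping reason: Leray–Hopf solutions are only defined up to slice-wise
  null sets (tree `IsLerayHopfOn.congr_ae_slices`), so the rest solution altered at the single space–time
  point `(1, 0)` is still a global Leray–Hopf solution from the datum `0` but is not continuous there.
  CLASS: refuted-MISSTATED (junk representative), not the print's failure.
* `clayA_of_steps_ae` — the repaired Step 2 (a representative smooth on `(0,∞) × ℝ³`, equal to `u(t)`
  a.e. for every `t > 0`; stated inline as hypothesis `h2`), granted together with the classical Steps 1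
  and 3 of the skeleton, still yields Fefferman's (A): the gap at §4.1.1–4.1.2 is summit-strength under
  either reading (the cell's verdict «unfilled gap» is unaffected by the repair).

WHAT THIS IS NOT: not a claim about NS regularity or blow-up; not a claim about any author beyond the
typed locator.
-/

set_option linter.dupNamespace false

noncomputable section

open Set Function MeasureTheory Filter
open scoped ContDiff Topology
open Literature.Analysis.FluidPDE Literature.Claims.NS.ZhangJiaHong2026

namespace Summit.NavierStokesRegularity.NavierStokesRegularity.Theorems.ZhangJiaHong2026

/-- The marked vector `e₀ = (1, 0, 0)`. [folklore] -/
def e0 : EuclideanSpace ℝ (Fin 3) := EuclideanSpace.single 0 1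

/-- `e₀ ≠ 0`. [folklore] -/
theorem e0_ne_zero : e0 ≠ 0 := by
  intro h
  have := congrArg (fun v : EuclideanSpace ℝ (Fin 3) => v 0) h
  simp [e0] at this

/-- The marked space–time point `z₀ = (1, 0)`. [folklore] -/
def z0 : ℝ × EuclideanSpace ℝ (Fin 3) := (1, 0)

/-- The junk representative: the rest solution altered at the single point `(t, x) = (1, 0)`. [folklore] -/
def spike : ℝ → EuclideanSpace ℝ (Fin 3) → EuclideanSpace ℝ (Fin 3) :=
  fun t x => Set.indicator {z0} (fun _ => e0) (t, x)

/-- `uncurry spike` is the indicator of the singleton `{z₀}`. [folklore] -/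
theorem uncurry_spike : uncurry spike = Set.indicator {z0} (fun _ => e0) := by
  funext z; rfl

/-- Every time slice of `spike` vanishes almost everywhere (it differs from `0` at most at `x = 0`). [folklore] -/
theorem spike_slice_ae_eq_zero (t : ℝ) :
    spike t =ᵐ[volume] (0 : ℝ → EuclideanSpace ℝ (Fin 3) → EuclideanSpace ℝ (Fin 3)) t := by
  have h0 : ∀ᵐ x ∂(volume : Measure (EuclideanSpace ℝ (Fin 3))), x ≠ 0 :=
    compl_mem_ae_iff.mpr (measure_singleton (0 : EuclideanSpace ℝ (Fin 3)))
  filter_upwards [h0] with x hx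
  have hz : ((t, x) : ℝ × EuclideanSpace ℝ (Fin 3)) ∉ ({z0} : Set _) := by
    intro h
    rw [Set.mem_singleton_iff, z0, Prod.mk.injEq] at h
    exact hx h.2
  simp [spike, Set.indicator_of_notMem hz]

/-- **`spike` is a global Leray–Hopf solution from the datum `0`** (slice-wise a.e. equal to the rest
solution; tree `isLerayHopfOn_zero`, `IsLerayHopfOn.congr_ae_slices`). [folklore] -/
theorem isGlobalLerayHopf_spike (ν : ℝ) : IsGlobalLerayHopf ν 0 spike := by
  intro T hT
  refine (isLerayHopfOn_zero (E := EuclideanSpace ℝ (Fin 3)) T ν).congr_ae_slices hT ?_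
    fun t _ => spike_slice_ae_eq_zero t
  rw [uncurry_spike]
  exact ((measurable_const.indicator (measurableSet_singleton z0)).aestronglyMeasurable)

/-- The zero datum lies in the (rendered) data class `L² ∩ V`. [folklore] -/
theorem isL2Datum_zero : IsL2Datum 0 := by
  refine ⟨contDiff_const, fun x => ?_, Or.inl (by simp)⟩
  simp only [NSWave0.divergence]
  rw [show (0 : EuclideanSpace ℝ (Fin 3) → EuclideanSpace ℝ (Fin 3)) = fun _ => 0 from rfl,
    fderiv_const_apply]
  simp

/-- `spike` is not continuous at `z₀`, hence not smooth on `(0,∞) × ℝ³`. [folklore] -/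
theorem not_isSmoothForPositiveTime_spike : ¬ IsSmoothForPositiveTime spike := by
  intro h
  have hmem : z0 ∈ Ioi (0 : ℝ) ×ˢ (univ : Set (EuclideanSpace ℝ (Fin 3))) :=
    ⟨by simp [z0], mem_univ _⟩
  have hA : ContinuousAt (uncurry spike) z0 :=
    (h.continuousOn.continuousWithinAt hmem).continuousAt
      ((isOpen_Ioi.prod isOpen_univ).mem_nhds hmem)
  have hval : uncurry spike z0 = e0 := by simp [uncurry_spike]
  have h1 : Tendsto (uncurry spike) (𝓝[≠] z0) (𝓝 e0) :=
    hval ▸ hA.tendsto.mono_left nhdsWithin_le_nhds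
  have h2 : Tendsto (uncurry spike) (𝓝[≠] z0) (𝓝 0) := by
    refine tendsto_const_nhds.congr' (eventually_nhdsWithin_of_forall fun z hz => ?_)
    rw [uncurry_spike, Set.indicator_of_notMem (by simpa using hz)]
  exact e0_ne_zero (tendsto_nhds_unique h1 h2)

/-- **Step 2 AS TYPED is false (C118; refuted-misstated, junk representative).** Witness: `ν = 1`, datum
`0`, and the global Leray–Hopf solution `spike` (the rest state altered at one point), which is not smooth
on `(0,∞) × ℝ³`. Repaired statement: hypothesis `h2` of `clayA_of_steps_ae` below (smooth representative), which
this witness does not touch. [cite: ZhangJiaHong2026, §4.1.1–4.1.2 p.5] -/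
theorem not_UniformHighOrderBounds : ¬ Literature.Claims.NS.ZhangJiaHong2026.UniformHighOrderBounds :=
  fun h => not_isSmoothForPositiveTime_spike (h 1 one_pos 0 isL2Datum_zero spike (isGlobalLerayHopf_spike 1))

/-- **Step 2 repaired (modulo representatives) is still summit-strength.** The repaired Step 2 — every
global Leray–Hopf solution of the class has a representative `v`, `v(t) = u(t)` a.e. for every `t > 0`, smooth
on `(0,∞) × ℝ³` (the honest reading of «u ∈ C^∞((0,∞); H^∞)» for an a.e.-defined `u`; hypothesis `h2`) —
together with the skeleton's Steps 1 and 3 gives Fefferman's (A). The smooth representative, re-glued to `u` at `t ≤ 0`, is itself a global Leray–Hopf solution from the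
same datum (`IsLerayHopfOn.congr_ae_slices`) and is smooth for `t > 0`, so Step 3 applies to it.
[cite: FeffermanClay2006, statement (A) p.2] -/
theorem clayA_of_steps_ae (h1 : LerayHopfExistence)
    (h2 : ∀ ν : ℝ, 0 < ν → ∀ u₀ : EuclideanSpace ℝ (Fin 3) → EuclideanSpace ℝ (Fin 3), IsL2Datum u₀ →
      ∀ u : ℝ → EuclideanSpace ℝ (Fin 3) → EuclideanSpace ℝ (Fin 3), IsGlobalLerayHopf ν u₀ u →
        ∃ v : ℝ → EuclideanSpace ℝ (Fin 3) → EuclideanSpace ℝ (Fin 3),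
          (∀ t, 0 < t → v t =ᵐ[volume] u t) ∧ IsSmoothForPositiveTime v)
    (h3 : HighRegularityFromZero) : Literature.Claims.NS.ClayVariants.clayR3.Regularity := by
  refine clay_of_claimed fun ν hν u₀ hu₀ => ?_
  have hL2 : IsL2Datum u₀ := isL2Datum_of_isClayDatum hu₀
  obtain ⟨u, hu⟩ := h1 ν hν u₀ hL2
  obtain ⟨v, hv, hvs⟩ := h2 ν hν u₀ hL2 u hu
  -- re-glue: `w = v` for `t > 0`, `w = u` for `t ≤ 0`
  set w : ℝ → EuclideanSpace ℝ (Fin 3) → EuclideanSpace ℝ (Fin 3) := fun t => if 0 < t then v t else u t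
    with hw_def
  have hw_pos : ∀ t, 0 < t → w t = v t := fun t ht => by simp [hw_def, ht]
  have hwEq : EqOn (uncurry w) (uncurry v) (Ioi (0 : ℝ) ×ˢ (univ : Set (EuclideanSpace ℝ (Fin 3)))) := by
    rintro ⟨t, x⟩ ⟨ht, -⟩
    simp [uncurry, hw_pos t ht]
  have hws : IsSmoothForPositiveTime w := hvs.congr hwEq
  have hwLH : IsGlobalLerayHopf ν u₀ w := by
    intro T hT
    refine (hu T hT).congr_ae_slices hT ?_ fun t _ => ?_
    · have hsub : Ioo (0 : ℝ) T ×ˢ (univ : Set (EuclideanSpace ℝ (Fin 3))) ⊆ Ioi 0 ×ˢ univ :=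
        prod_mono Ioo_subset_Ioi_self le_rfl
      exact ((hws.continuousOn.mono hsub).aestronglyMeasurable
        (measurableSet_Ioo.prod MeasurableSet.univ)).congr (ae_of_all _ fun _ => rfl)
    · by_cases ht : 0 < t
      · rw [hw_pos t ht]; exact hv t ht
      · have : w t = u t := by simp [hw_def, ht]
        rw [this]
  exact h3 ν hν u₀ hu₀ w hwLH hws

end Summit.NavierStokesRegularity.NavierStokesRegularity.Theorems.ZhangJiaHong2026

end
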